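import Mathlib
import Summits.ValiantsHypothesis.ValiantsHypothesis.Theorems.FifoMatchingNNLinearDegreeCofactorHardRateGrowth
import HarnessLib

/-!
# Crux `NNLinearDegreeCofactorHard` (stmt-ValiantsHypothesis-23918), line `internal_cofactor`: the growth condition `hr` of
# `avoidingCounts28_of_pricing` for ANY polynomial rate (`stub_params`, LEAD p2; covers `ShedWord.heart`'s `N^{1/12}`)

`…RateGrowth.hr_of_quarterRoot` (p603204) discharges the hypothesis `hr` of `InternalCofactor.avoidingCounts28_of_pricing` for
quarter-root rates.  p1's heart (`ShedWord.heart`, U5) yields `tests + passages ≥ c·N^{1/12}`, so the assembly needs the same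
fact for an arbitrary root: this file proves it for every rate `r` with `M < (C₀·(r M + 1))^d` for all large `M` (any fixed
`d ≥ 1`, `C₀`), i.e. `r M + 1 ≥ M^{1/d}/C₀`:

* `eventually_poly_le_two_pow'` — `5C₀((d(p+1)+5+c)^c + 2d(p+1) + 7) + 1 ≤ 2^p` for all large `p`;
* `hr_of_root` — **the growth condition**: ∀ c, ∃ n₀, ∀ n ≥ n₀, ∀ M, n ≤ 14(M+2) →
  `8·(2^((log₂ n + c)^c) + 1)·(M+1)²·(3/4)^{r M} < 1`.

Honest framing: arithmetic; nothing here proves the pricing, S2b, the crux or VP ≠ VNP.  No definitions, no named facts.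
-/

-- Sub = Summit single-conjunct layout: the duplicated namespace component is mandated by the tree.
set_option linter.dupNamespace false

namespace Summit.ValiantsHypothesis.ValiantsHypothesis.Theorems.FifoMatching.NNLinearDegreeCofactorHard.InternalCofactor

open Finset Filter
open Summit.ValiantsHypothesis.ValiantsHypothesis.Theorems.FifoMatching.NNMonotoneHard

/-- **Polynomial versus exponential** (root version): `5·C₀·((d(p+1) + 5 + c)^c + 2d(p+1) + 7) + 1 ≤ 2^p` for all large `p`.
[folklore] -/
theorem eventually_poly_le_two_pow' (c C₀ d : ℕ) :
    ∃ p₀ : ℕ, ∀ p : ℕ, p₀ ≤ p →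
      5 * C₀ * ((d * (p + 1) + 5 + c) ^ c + 2 * d * (p + 1) + 7) + 1 ≤ 2 ^ p := by
  set K : ℕ := 5 * C₀ * ((d + 5 + c) ^ c + 2 * d + 7) + 1 with hK
  have E := eventually_const_mul_pow_mul_pow_lt (c + 1) (C := ((K * 2 ^ (c + 1) : ℕ) : ℝ)) (a := 1 / 2)
    (by norm_num) (by norm_num) one_pos
  obtain ⟨p₀, hp₀⟩ := Filter.eventually_atTop.1 ((eventually_ge_atTop 1).and E)
  refine ⟨p₀, fun p hp => ?_⟩
  obtain ⟨hp1, hE⟩ := hp₀ p hp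
  have h1 : d * (p + 1) + 5 + c ≤ (d + 5 + c) * (p + 1) := by nlinarith
  have h2 : (d * (p + 1) + 5 + c) ^ c ≤ (d + 5 + c) ^ c * (p + 1) ^ c := by
    calc (d * (p + 1) + 5 + c) ^ c ≤ ((d + 5 + c) * (p + 1)) ^ c := Nat.pow_le_pow_left h1 c
      _ = (d + 5 + c) ^ c * (p + 1) ^ c := mul_pow _ _ _
  have hp1c : (p + 1) ^ c ≤ (p + 1) ^ (c + 1) := Nat.pow_le_pow_right (by omega) (by omega)
  have hpc1 : 1 ≤ (p + 1) ^ (c + 1) := Nat.one_le_pow _ _ (by omega)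
  have hp11 : p + 1 ≤ (p + 1) ^ (c + 1) := Nat.le_self_pow (by omega) _
  have hA : (d + 5 + c) ^ c * (p + 1) ^ c ≤ (d + 5 + c) ^ c * (p + 1) ^ (c + 1) := Nat.mul_le_mul_left _ hp1c
  have hB : 2 * d * (p + 1) + 7 ≤ (2 * d + 7) * (p + 1) ^ (c + 1) :=
    calc 2 * d * (p + 1) + 7 ≤ (2 * d + 7) * (p + 1) := by nlinarith
      _ ≤ (2 * d + 7) * (p + 1) ^ (c + 1) := Nat.mul_le_mul_left _ hp11
  have h3 : (d * (p + 1) + 5 + c) ^ c + 2 * d * (p + 1) + 7 ≤ ((d + 5 + c) ^ c + (2 * d + 7)) * (p + 1) ^ (c + 1) :=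
    calc (d * (p + 1) + 5 + c) ^ c + 2 * d * (p + 1) + 7
        = (d * (p + 1) + 5 + c) ^ c + (2 * d * (p + 1) + 7) := by ring
      _ ≤ (d + 5 + c) ^ c * (p + 1) ^ (c + 1) + (2 * d + 7) * (p + 1) ^ (c + 1) :=
          Nat.add_le_add (h2.trans hA) hB
      _ = ((d + 5 + c) ^ c + (2 * d + 7)) * (p + 1) ^ (c + 1) := by ring
  have h4 : 5 * C₀ * ((d * (p + 1) + 5 + c) ^ c + 2 * d * (p + 1) + 7) + 1 ≤ K * (p + 1) ^ (c + 1) :=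
    calc 5 * C₀ * ((d * (p + 1) + 5 + c) ^ c + 2 * d * (p + 1) + 7) + 1
        ≤ 5 * C₀ * (((d + 5 + c) ^ c + (2 * d + 7)) * (p + 1) ^ (c + 1)) + (p + 1) ^ (c + 1) :=
          Nat.add_le_add (Nat.mul_le_mul_left _ h3) hpc1
      _ = K * (p + 1) ^ (c + 1) := by rw [hK]; ring
  have h5 : (p + 1) ^ (c + 1) ≤ 2 ^ (c + 1) * p ^ (c + 1) := by
    rw [← mul_pow]; exact Nat.pow_le_pow_left (by omega) _
  have h6 : ((K * 2 ^ (c + 1) : ℕ) : ℝ) * (p : ℝ) ^ (c + 1) < 2 ^ p := by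
    have h2p : (0 : ℝ) < 2 ^ p := by positivity
    have := hE
    rw [show (1 / 2 : ℝ) ^ p = 1 / 2 ^ p by rw [one_div, inv_pow, one_div]] at this
    rw [mul_one_div, div_lt_one h2p] at this
    exact this
  have h7 : K * 2 ^ (c + 1) * p ^ (c + 1) < 2 ^ p := by exact_mod_cast h6
  calc 5 * C₀ * ((d * (p + 1) + 5 + c) ^ c + 2 * d * (p + 1) + 7) + 1 ≤ K * (p + 1) ^ (c + 1) := h4
    _ ≤ K * (2 ^ (c + 1) * p ^ (c + 1)) := Nat.mul_le_mul_left _ h5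
    _ = K * 2 ^ (c + 1) * p ^ (c + 1) := by ring
    _ ≤ 2 ^ p := h7.le

/-- **`hr` for any polynomial rate.**  If `M < (C₀·(r M + 1))^d` for all `M ≥ M₀` (`d ≥ 1`), then for every `c`, eventually in
`n`, `8·(2^((log₂ n + c)^c) + 1)·(M+1)²·(3/4)^{r M} < 1` whenever `n ≤ 14(M+2)`. [folklore] -/
theorem hr_of_root (r : ℕ → ℕ) (C₀ d M₀ : ℕ) (hd : 1 ≤ d)
    (hrate : ∀ M : ℕ, M₀ ≤ M → M < (C₀ * (r M + 1)) ^ d) :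
    ∀ c : ℕ, ∃ n₀ : ℕ, ∀ n ≥ n₀, ∀ M : ℕ, n ≤ 14 * (M + 2) →
      (8 * (2 ^ ((Nat.log 2 n + c) ^ c) + 1) * (M + 1) ^ 2 : ℝ) * (3 / 4 : ℝ) ^ (r M) < 1 := by
  intro c
  obtain ⟨p₀, hp₀⟩ := eventually_poly_le_two_pow' c C₀ d
  refine ⟨14 * (max M₀ (2 ^ (d * (p₀ + 1))) + 2), fun n hn M hM => ?_⟩
  have hMge : max M₀ (2 ^ (d * (p₀ + 1))) ≤ M := by omega
  have hM₀ : M₀ ≤ M := le_trans (le_max_left _ _) hMge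
  have hM2 : 2 ^ (d * (p₀ + 1)) ≤ M := le_trans (le_max_right _ _) hMge
  -- `q := C₀ (r M + 1)` with `M < q^d`; its logarithm `p ≥ p₀ + 1`
  set q := C₀ * (r M + 1) with hq
  have hMq : M < q ^ d := hrate M hM₀
  have hq2 : 2 ^ (p₀ + 1) < q := by
    by_contra hle
    push Not at hle
    have : q ^ d ≤ (2 ^ (p₀ + 1)) ^ d := Nat.pow_le_pow_left hle d
    rw [← pow_mul, show (p₀ + 1) * d = d * (p₀ + 1) by ring] at this
    omega
  have hq1 : 1 ≤ q := by have := Nat.one_le_two_pow (n := p₀ + 1); omega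
  set p := Nat.log 2 q with hp
  have hp₀p : p₀ + 1 ≤ p := Nat.le_log_of_pow_le (by norm_num) hq2.le
  have hgrow := hp₀ p (by omega)
  have hq_lt : q < 2 ^ (p + 1) := Nat.lt_pow_succ_log_self (by norm_num) _
  have hq_ge : 2 ^ p ≤ q := Nat.pow_log_le_self 2 (by omega)
  -- `M + 1 ≤ q^d < 2^(d(p+1))`, `n < 2^(d(p+1)+5)`
  have hM1 : M + 1 ≤ q ^ d := hMq
  have hqd : q ^ d < 2 ^ (d * (p + 1)) := by
    calc q ^ d < (2 ^ (p + 1)) ^ d := Nat.pow_lt_pow_left hq_lt (by omega)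
      _ = 2 ^ (d * (p + 1)) := by rw [← pow_mul]; ring_nf
  have hn_lt : n < 2 ^ (d * (p + 1) + 5) := by
    calc n ≤ 14 * (M + 2) := hM
      _ ≤ 28 * q ^ d := by nlinarith
      _ < 32 * 2 ^ (d * (p + 1)) := by omega
      _ = 2 ^ (d * (p + 1) + 5) := by rw [show (32 : ℕ) = 2 ^ 5 by norm_num, ← pow_add]; ring_nf
  have hlog : Nat.log 2 n ≤ d * (p + 1) + 4 := by
    rcases Nat.eq_zero_or_pos n with h0 | hpos
    · rw [h0, Nat.log_zero_right]; omega
    · have := (Nat.log_lt_iff_lt_pow (by norm_num) hpos.ne').2 hn_lt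
      omega
  set L := (Nat.log 2 n + c) ^ c with hL
  have hLle : L ≤ (d * (p + 1) + 5 + c) ^ c := Nat.pow_le_pow_left (by omega) c
  have hC₀ : 1 ≤ C₀ := by
    by_contra h0
    push Not at h0
    have hz : C₀ = 0 := by omega
    rw [hz, zero_mul] at hq
    omega
  have h5C : 0 < 5 * C₀ := by omega
  -- `j := (r M + 1) / 5`, so `5 j ≤ r M + 1` and `j ≥ (q / C₀) / 5 - 1`-ish
  set j := (r M + 1) / 5 with hj
  have hrM : 5 * j ≤ r M + 1 := by rw [hj, mul_comm]; exact Nat.div_mul_le_self _ _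
  -- `(d(p+1)+5+c)^c + 2d(p+1) + 7 ≤ j`: from `hgrow` and `q = C₀ (r M + 1) ≥ 2^p`
  have hjge : (d * (p + 1) + 5 + c) ^ c + 2 * d * (p + 1) + 7 ≤ j := by
    rw [hj, Nat.le_div_iff_mul_le (by norm_num)]
    -- `5 X ≤ r M + 1` where `C₀ (r M + 1) = q ≥ 2^p ≥ 5 C₀ X + C₀`… use `hgrow : 5 C₀ X + 1 ≤ 2^p`
    have h1 : C₀ * (5 * ((d * (p + 1) + 5 + c) ^ c + 2 * d * (p + 1) + 7)) < C₀ * (r M + 1) := by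
      calc C₀ * (5 * ((d * (p + 1) + 5 + c) ^ c + 2 * d * (p + 1) + 7))
          = 5 * C₀ * ((d * (p + 1) + 5 + c) ^ c + 2 * d * (p + 1) + 7) := by ring
        _ < 2 ^ p := by omega
        _ ≤ q := hq_ge
        _ = C₀ * (r M + 1) := hq
    have := Nat.lt_of_mul_lt_mul_left h1
    omega
  have hj1 : 1 ≤ j := le_trans (by omega) hjge
  -- the key bound in `ℕ`: `22 · 2^L · (M+1)^2 ≤ 4^j`
  have hkey : 22 * 2 ^ L * (M + 1) ^ 2 ≤ 4 ^ j := by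
    have hM2' : (M + 1) ^ 2 ≤ 2 ^ (2 * (d * (p + 1))) := by
      calc (M + 1) ^ 2 ≤ (q ^ d) ^ 2 := Nat.pow_le_pow_left hM1 2
        _ ≤ (2 ^ (d * (p + 1))) ^ 2 := Nat.pow_le_pow_left hqd.le 2
        _ = 2 ^ (2 * (d * (p + 1))) := by rw [← pow_mul]; ring_nf
    have h2L : 2 ^ L ≤ 2 ^ ((d * (p + 1) + 5 + c) ^ c) := Nat.pow_le_pow_right (by norm_num) hLle
    calc 22 * 2 ^ L * (M + 1) ^ 2 ≤ 32 * 2 ^ ((d * (p + 1) + 5 + c) ^ c) * 2 ^ (2 * (d * (p + 1))) :=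
          Nat.mul_le_mul (Nat.mul_le_mul (by norm_num) h2L) hM2'
      _ = 2 ^ (5 + (d * (p + 1) + 5 + c) ^ c + 2 * (d * (p + 1))) := by
          rw [show (32 : ℕ) = 2 ^ 5 by norm_num, ← pow_add, ← pow_add]
      _ ≤ 2 ^ (2 * j) := Nat.pow_le_pow_right (by norm_num) (by nlinarith)
      _ = 4 ^ j := by rw [pow_mul]; norm_num
  -- conclude in `ℝ` (verbatim the end of `hr_of_quarterRoot`)
  have hkeyR : (22 * 2 ^ L * (M + 1) ^ 2 : ℝ) ≤ 4 ^ j := by exact_mod_cast hkey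
  have h34 : (3 / 4 : ℝ) ^ (r M) ≤ (4 / 3) * (1 / 4 : ℝ) ^ j := by
    have h1 : (3 / 4 : ℝ) ^ (r M + 1) ≤ (3 / 4 : ℝ) ^ (5 * j) :=
      pow_le_pow_of_le_one (by norm_num) (by norm_num) hrM
    have h2 := three_quarters_pow_five_mul_le j
    have h3 : (3 / 4 : ℝ) ^ (r M) = (4 / 3) * (3 / 4 : ℝ) ^ (r M + 1) := by rw [pow_succ]; ring
    rw [h3]
    exact mul_le_mul_of_nonneg_left (h1.trans h2) (by norm_num)
  have h4j : (0 : ℝ) < 4 ^ j := by positivity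
  have h14 : (1 / 4 : ℝ) ^ j = 1 / 4 ^ j := by rw [one_div, inv_pow, one_div]
  set X : ℝ := (2 : ℝ) ^ L * ((M : ℝ) + 1) ^ 2 with hX
  have hX0 : 0 ≤ X := by positivity
  have hXle : 22 * X ≤ 4 ^ j := by rw [hX]; linarith [hkeyR]
  have h2L1 : (2 : ℝ) ^ L + 1 ≤ 2 * 2 ^ L := by
    have : (1 : ℝ) ≤ 2 ^ L := one_le_pow₀ (by norm_num)
    linarith
  have hM0 : (0 : ℝ) ≤ ((M : ℝ) + 1) ^ 2 := sq_nonneg _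
  have hstep1 : (8 * (2 ^ L + 1) * (M + 1) ^ 2 : ℝ) ≤ 16 * X := by
    have h := mul_le_mul_of_nonneg_right h2L1 hM0
    have h' : ((2 : ℝ) ^ L + 1) * ((M : ℝ) + 1) ^ 2 ≤ 2 * X := by rw [hX]; linarith
    linarith
  have hLdef : (2 : ℝ) ^ ((Nat.log 2 n + c) ^ c) = 2 ^ L := by rw [hL]
  calc (8 * (2 ^ ((Nat.log 2 n + c) ^ c) + 1) * (M + 1) ^ 2 : ℝ) * (3 / 4 : ℝ) ^ (r M)
      = (8 * (2 ^ L + 1) * (M + 1) ^ 2 : ℝ) * (3 / 4 : ℝ) ^ (r M) := by rw [hLdef]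
    _ ≤ (16 * X) * ((4 / 3) * (1 / 4 : ℝ) ^ j) :=
        mul_le_mul hstep1 h34 (pow_nonneg (by norm_num) _) (by linarith)
    _ = (64 / 3) * (X / 4 ^ j) := by rw [h14]; ring
    _ ≤ (64 / 3) * (1 / 22) := by
        apply mul_le_mul_of_nonneg_left _ (by norm_num)
        rw [div_le_div_iff₀ h4j (by norm_num), one_mul]
        linarith
    _ < 1 := by norm_num

end Summit.ValiantsHypothesis.ValiantsHypothesis.Theorems.FifoMatching.NNLinearDegreeCofactorHard.InternalCofactor
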